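import Literature.MathematicalPhysics.QuantumFieldTheory.Balaban1983to89.B3ScalarLegParity
import Literature.MathematicalPhysics.QuantumFieldTheory.Balaban1983to89.B3OddVectorLoops
import Literature.MathematicalPhysics.QuantumFieldTheory.Balaban1983to89.B3Graph24Unique

/-!
# `Balaban1983to89.B3Sect3DegreeCensus` — T. Bałaban, *(Higgs)₂,₃ quantum fields in a finite volume. III. Renormalization*,
Commun. Math. Phys. **88** (1983) 411–445 [Balaban1983Higgs3]: the EXACT DEGREE FORMULA behind the degree bookkeeping of Sect. 3
(pp. 435–443) and of the counterterm truncations (1.23)/(1.24) (pp. 417–418), on the concrete family of graphs `B3Cor23Concrete.Graph`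

statement-level skeleton of published theorems with citation tags; proofs where landed; nothing here is a claim about the Yang–Mills mass gap

PDF held: `paper:balaban1983-higgs-2-3-quantum-fields-finite-volume` (journal page = PDF page + 410); renders read as images for every
quotation: `run/shared/lean/pub/pub-balaban/b2b-balaban-ref1/pages/1983-cmp88-higgs23-III/1983-cmp88-higgs23-III-p007, p008, p013,
p025, p028, p029, p032, p033-x2.png` (journal pp. 417, 418, 423, 435, 438, 439, 442, 443).
CITATION HEADER (lean-in-tree rule).  lit-balaban TYPED SKELETON (HOME `run/shared/lean/pub/lit-balaban/`), Phase 2, seat p18 (gen 3),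
unit `lit-balaban-p18`; SKELETON rows served (fold owner r15): **B3.Eq1.23** / **B3.Eq1.24** (the truncation sentences pp. 417–418),
and — through the sibling modules `…B3Sect3ScalarSEDegrees`, `…B3Sect3DivergentClasses`, `…B3Sect3LowestOrderGraphs` which consume
the formula — **B3.Eq3.6-3.9**, **B3.Eq3.18-3.20**, **B3.Eq3.21-3.24**, **B3.Eq3.25-3.32**, **B3.Eq3.33-3.38** (their degree sentences).
The model (`B3Cor23Concrete`, seat p18 gen 1): graphs of admissible catalogue vertices (1.6)–(1.15) (`B3Prop1.VertexKind`), internal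
lines = the pairing «other endpoint» of φ′/A′-legs, mass renormalization vertices in the attached form of p. 423, D(G) = (2.2);
external vector legs = uncontracted A′-legs (`numExtVectorLegs`) and legs of the external field Ã (`numTildeLegs`) — gen 2 conventions
(`B3DivergentGraphs`).  Connectedness is not imposed (every statement below holds for all graphs of the model).

WHAT THIS MODULE PROVES (sorry-free; five `def`s with bodies = counts; no `Prop` fact introduced).
(1) `degree_eq_closedForm`: table (i)–(iv) p. 423 in one formula — for a vertex not of the form (1.13)–(1.15), D(v) = n(4−d)/2 + n′
+ [v = (1.6)](4−d) + [v = (1.7)]·2.  (2) `two_deg_eq` (every d): for a graph without vertices (1.13)–(1.15),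
2·D(G) = (4−d)·(internal A′-legs) + 2·(external A′-legs) + 2·(Ã-legs) + 2(4−d)·#(1.6) + 4·#(1.7) + (d−2)·(external φ′-legs)
+ 2·(differentiations on external legs) − 2d; in d = 3, 2·D(G) = `budget` − 6 (`two_deg_three_eq_budget`), also for every graph
with D(G) ≤ 0 (Cor. 2.3 excludes (1.13)–(1.15)).  (3) structural counts: #vertices ≤ #(1.6) + #(1.7) + e-order (`nV_le`), 2·#vertices
+ 2·#(1.6) = external + internal φ′-legs (`two_nV_add_eq`), the catalogue vertices without / with ≤ 2 Ã-legs (`kind_cases_noTilde`,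
`kind_cases_tilde_le_two`), one- and two-vertex sums.  (4) pp. 417–418 PROVED on the model (d = 3): for the graphs with two external
φ′-legs only, 2·D(G) = e-order + 2·#(1.6) + 4·#(1.7) + 2·(ext. differentiations) − 4, so *"the terms of order higher than 4 (in
coupling constants) … are convergent"* (`deg_pos_of_order_gt_four`, order = α + 2β with each (1.7)-vertex counted with its least
order 2); for the vacuum graphs the same with − 6, so beyond *"2 ≤ α + 2β ≤ 6 … the other terms are convergent"*
(`deg_pos_of_order_gt_six`).  NOT here: convergence itself (Prop. 1 / Prop. 2.1 are statement rows); the e-order of the model counts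
the legs n + n′ of (1.8)–(1.11) (the printed (e(L^kε))^{n+n′}) and the λ-order the vertices (1.6).
-/

namespace Literature.MathematicalPhysics.QuantumFieldTheory.Balaban1983to89.B3Sect3DegreeCensus

open Finset B3Prop1 B3Sect2Statements B3VertexBridge B3Cor23Concrete B3DivergentGraphs B3ScalarLegParity B3OddVectorLoops

variable {nbar : ℕ}

/-! ## The counts of a graph entering the degree formula -/

section Counts

variable (G : Graph nbar)

/-- The number of vertices (1.6) (the φ⁴ vertex, coupling λ) of G. [cite: Balaban1983Higgs3, (1.6) p.413] -/
def numV16 : ℕ := (univ.filter fun i => G.kind i = .v16).card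

/-- The number of mass renormalization vertices (1.7) of G. [cite: Balaban1983Higgs3, (1.7) p.413] -/
def numV17 : ℕ := (univ.filter fun i => G.kind i = .v17).card

/-- The number of A′-legs of G lying on internal lines (twice the number of internal vector lines, `even_numIntVectorLegs`).
[cite: Balaban1983Higgs3, (2.1) p.422] -/
def numIntVectorLegs : ℕ := ∑ i, G.intVector i

/-- The order of G in the coupling e(L^kε): the total number n + n′ of vector legs (A′ and Ã) of its vertices (1.8)–(1.11),
(1.14)–(1.15) (each such vertex carries (e(L^kε))^{n+n′}, pp. 413–414). [cite: Balaban1983Higgs3, (1.8) p.413] -/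
def eOrder : ℕ := ∑ i, (G.kind i).dv

/-- The d = 3 degree budget of G: (internal A′-legs) + 2·(external A′-legs) + 2·(Ã-legs) + 2·(vertices (1.6)) + 4·(vertices (1.7))
+ (external φ′-legs) + 2·(differentiations acting on external legs); `two_deg_three_eq_budget`: 2·D(G) = budget − 6.
[cite: Balaban1983Higgs3, (2.2) p.423] -/
def budget : ℕ :=
  numIntVectorLegs G + 2 * numExtVectorLegs G + 2 * numTildeLegs G + 2 * numV16 G + 4 * numV17 G
    + numExtScalarLegs G + 2 * numExtDiffs G

/-- kernel: the internal A′-legs are even in number (they are paired by the vector lines, p. 414).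
[cite: Balaban1983Higgs3, p.414] -/
theorem even_numIntVectorLegs : Even (numIntVectorLegs G) := even_sum_intVector G

/-- kernel: the e-order is the total number of vector legs: internal A′-legs + external A′-legs + Ã-legs.
[cite: Balaban1983Higgs3, p.420] -/
theorem eOrder_eq : eOrder G = numIntVectorLegs G + numExtVectorLegs G + numTildeLegs G := sum_dv_eq G

/-- kernel: `numV16` as a sum of indicators. [cite: Balaban1983Higgs3, (1.6) p.413] -/
theorem numV16_eq_sum : numV16 G = ∑ i, if G.kind i = .v16 then 1 else 0 := by
  rw [numV16, card_filter]

/-- kernel: `numV17` as a sum of indicators. [cite: Balaban1983Higgs3, (1.7) p.413] -/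
theorem numV17_eq_sum : numV17 G = ∑ i, if G.kind i = .v17 then 1 else 0 := by
  rw [numV17, card_filter]

end Counts

/-! ## The all-internal degree D(v) of p. 423 in closed form -/

/-- Table (i)–(iv) p. 423 [PDF 13] in one formula: for a catalogue vertex NOT of the form (1.13)–(1.15),
D(v) = n·(4−d)/2 + n′ + [v = (1.6)]·(4−d) + [v = (1.7)]·2, n = its A′-legs, n′ = its Ã-legs (for the R-vertices n′ = n̄+1).
[cite: Balaban1983Higgs3, p.423] -/
theorem degree_eq_closedForm (d : ℕ) (v : VertexKind) (h : v.isOfForm1315 = false) :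
    degree d (toCounts d v) = (v.vectorLegs : ℚ) * ((4 - (d : ℚ)) / 2) + v.extVectorLegs
      + (if v = .v16 then 4 - (d : ℚ) else 0) + (if v = .v17 then 2 else 0) := by
  cases v with
  | v16 => rw [toCounts_v16, degree_v16]; simp [VertexKind.vectorLegs, VertexKind.extVectorLegs]
  | v17 => rw [toCounts_v17, degree_v17]; simp [VertexKind.vectorLegs, VertexKind.extVectorLegs]
  | v18 n n' => rw [toCounts_v18, degree_v18]; simp [VertexKind.vectorLegs, VertexKind.extVectorLegs]
  | v19 n nb => rw [toCounts_v19, degree_v18]; simp [VertexKind.vectorLegs, VertexKind.extVectorLegs]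
  | v110 n n' => rw [toCounts_v110, degree_v110]; simp [VertexKind.vectorLegs, VertexKind.extVectorLegs]
  | v111 n nb => rw [toCounts_v111, degree_v110]; simp [VertexKind.vectorLegs, VertexKind.extVectorLegs]
  | v113 => simp [VertexKind.isOfForm1315] at h
  | v114 n n' => simp [VertexKind.isOfForm1315] at h
  | v115 n nb => simp [VertexKind.isOfForm1315] at h

/-! ## The exact degree formula of a graph without vertices of the form (1.13)–(1.15) -/

section Formula

variable (G : Graph nbar)

/-- kernel: a graph without vertices of the form (1.13)–(1.15), vertex by vertex. [cite: Balaban1983Higgs3, Cor. 2.3 p.429] -/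
theorem isOfForm1315_eq_false (hG : ¬ G.HasVertex1315) (i : Fin G.nV) : (G.kind i).isOfForm1315 = false := by
  simpa using fun hc => hG ⟨i, hc⟩

/-- kernel: the A′-legs of the vertices = internal A′-legs + external A′-legs. [cite: Balaban1983Higgs3, p.414] -/
theorem sum_vectorLegs_eq : ∑ i, (G.kind i).vectorLegs = numIntVectorLegs G + numExtVectorLegs G := by
  unfold numIntVectorLegs numExtVectorLegs
  rw [← sum_add_distrib]
  exact sum_congr rfl fun i _ => by have := G.intVector_le i; omega

/-- Σ_v D(v) over a graph without vertices (1.13)–(1.15), by `degree_eq_closedForm` and the handshake for the A′-legs: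
Σ_v D(v) = (internal + external A′-legs)·(4−d)/2 + (Ã-legs) + (4−d)·#(1.6) + 2·#(1.7). [cite: Balaban1983Higgs3, p.423] -/
theorem sum_degree_eq (d : ℕ) (hG : ¬ G.HasVertex1315) :
    ∑ i, degree d (toCounts d (G.kind i)) =
      ((numIntVectorLegs G + numExtVectorLegs G : ℕ) : ℚ) * ((4 - (d : ℚ)) / 2) + numTildeLegs G
        + (numV16 G : ℚ) * (4 - (d : ℚ)) + 2 * (numV17 G : ℚ) := by
  rw [sum_congr rfl fun i _ => degree_eq_closedForm d (G.kind i) (isOfForm1315_eq_false G hG i), sum_add_distrib,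
    sum_add_distrib, sum_add_distrib, ← sum_mul, ← sum_vectorLegs_eq, numV16_eq_sum, numV17_eq_sum]
  unfold numTildeLegs
  push_cast
  rw [sum_ite, sum_ite, sum_const_zero, sum_const_zero, add_zero, add_zero, sum_const, sum_const, nsmul_eq_mul,
    nsmul_eq_mul, sum_boole, sum_boole]
  ring

/-- **The degree formula** ((2.1)–(2.2) summed, every dimension d): for a graph of the model without vertices of the form
(1.13)–(1.15), 2·D(G) = (4−d)·(internal A′-legs) + 2·(external A′-legs) + 2·(Ã-legs) + 2(4−d)·#(1.6) + 4·#(1.7)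
+ (d−2)·(external φ′-legs) + 2·(differentiations on external legs) − 2d. [cite: Balaban1983Higgs3, (2.2) p.423] -/
theorem two_deg_eq (d : ℕ) (hG : ¬ G.HasVertex1315) :
    2 * G.deg d = (4 - (d : ℚ)) * numIntVectorLegs G + 2 * numExtVectorLegs G + 2 * numTildeLegs G
      + 2 * (4 - (d : ℚ)) * numV16 G + 4 * numV17 G + ((d : ℚ) - 2) * numExtScalarLegs G
      + 2 * numExtDiffs G - 2 * d := by
  rw [deg_eq_sum G d (isAveragingVertex_eq_false G hG), sum_degree_eq G d hG, numExtLegs_eq_add]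
  push_cast
  ring

/-- **d = 3**: 2·D(G) = budget − 6 for a graph without vertices (1.13)–(1.15). [cite: Balaban1983Higgs3, (2.2) p.423] -/
theorem two_deg_three_eq_budget (hG : ¬ G.HasVertex1315) : 2 * G.deg 3 = (budget G : ℚ) - 6 := by
  rw [two_deg_eq G 3 hG, budget]
  push_cast
  ring

/-- d = 3: a divergent graph (D ≤ 0) has no vertex (1.13)–(1.15) (Cor. 2.3), so 2·D(G) = budget − 6.
[cite: Balaban1983Higgs3, Cor. 2.3 p.429] -/
theorem two_deg_three_eq_budget_of_nonpos (hD : G.deg 3 ≤ 0) : 2 * G.deg 3 = (budget G : ℚ) - 6 :=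
  two_deg_three_eq_budget G (not_hasVertex1315_of_deg_nonpos G hD)

/-- d = 3: D(G) ≤ 0 ⇒ budget ≤ 6. [cite: Balaban1983Higgs3, (2.17) p.429] -/
theorem budget_le_six (hD : G.deg 3 ≤ 0) : budget G ≤ 6 := by
  have := two_deg_three_eq_budget_of_nonpos G hD
  have : (budget G : ℚ) ≤ 6 := by linarith
  exact_mod_cast this

/-! ### Two structural counts: vertices against orders, φ′-legs against vertices -/

/-- kernel: every admissible vertex other than (1.6), (1.7), (1.13) has a vector leg ((1.8): n + n′ ≥ 1; (1.10): n + n′ ≥ 2;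
the R-vertices carry n̄ + 1 legs of Ã), so #vertices ≤ #(1.6) + #(1.7) + (e-order) for a graph without vertices (1.13)–(1.15).
[cite: Balaban1983Higgs3, (1.8)–(1.11) p.413] -/
theorem nV_le (hG : ¬ G.HasVertex1315) : G.nV ≤ numV16 G + numV17 G + eOrder G := by
  have key : ∀ i, 1 ≤ (if G.kind i = .v16 then 1 else 0) + (if G.kind i = .v17 then 1 else 0) + (G.kind i).dv := by
    intro i
    have hadm := G.adm i
    have h1315 := isOfForm1315_eq_false G hG i
    generalize G.kind i = v at hadm h1315 ⊢
    cases v <;> simp [VertexKind.Admissible, VertexKind.isOfForm1315, VertexKind.dv] at hadm h1315 ⊢ <;> omega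
  have := sum_le_sum fun i (_ : i ∈ (univ : Finset (Fin G.nV))) => key i
  rw [sum_const, card_univ, Fintype.card_fin, smul_eq_mul, mul_one, sum_add_distrib, sum_add_distrib,
    ← numV16_eq_sum, ← numV17_eq_sum] at this
  exact this

/-- kernel: a graph has at least one vertex (it has a line, p. 415). [cite: Balaban1983Higgs3, p.415] -/
theorem one_le_nV : 1 ≤ G.nV := by
  obtain ⟨x, -⟩ := G.exists_line; exact Fin.pos x.1

/-- kernel: the φ′-legs of a graph without vertices (1.13)–(1.15) counted two ways: 2·#vertices + 2·#(1.6) =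
(external φ′-legs) + (internal φ′-legs) ((1.6) has four φ′-legs, (1.7)–(1.11) two). [cite: Balaban1983Higgs3, p.414] -/
theorem two_nV_add_eq (hG : ¬ G.HasVertex1315) :
    2 * G.nV + 2 * numV16 G = numExtScalarLegs G + ∑ i, G.intScalar i := by
  have key : ∀ i, (G.kind i).scalarLegs = 2 + 2 * (if G.kind i = .v16 then 1 else 0) := by
    intro i
    have h1315 := isOfForm1315_eq_false G hG i
    generalize G.kind i = v at h1315 ⊢
    cases v <;> simp [VertexKind.isOfForm1315, VertexKind.scalarLegs] at h1315 ⊢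
  have h := sum_scalarLegs_eq G
  rw [card_intScalarLegSet, sum_congr rfl fun i _ => key i, sum_add_distrib, sum_const, card_univ, Fintype.card_fin,
    smul_eq_mul, ← mul_sum, ← numV16_eq_sum] at h
  omega

/-- kernel: the internal φ′-legs are even in number. [cite: Balaban1983Higgs3, p.414] -/
theorem even_sum_intScalar : Even (∑ i, G.intScalar i) := by
  rw [← card_intScalarLegSet]; exact even_card_intScalarLegSet G

/-- kernel: the differentiations on external legs, vertex by vertex: X = Σ_v (diffCount − intDiffs), and a vertex (1.8)/(1.9)
with no internal φ′-leg has its differentiation external. [cite: Balaban1983Higgs3, (2.1) p.422] -/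
theorem numExtDiffs_eq : numExtDiffs G = ∑ i, ((G.kind i).diffCount - G.intDiffs i) := rfl

end Formula


/-! ## Vertex kinds and small vertex sets -/

section Kinds

/-- kernel: an admissible catalogue vertex other than (1.6), (1.7), (1.13)–(1.15) WITHOUT legs of Ã is a vertex (1.8) with
n ≥ 1 or a vertex (1.10) with n ≥ 2 legs of A′ (the R-vertices carry n̄ + 1 ≥ 1 legs of Ã). [cite: Balaban1983Higgs3, (1.8)–(1.11) p.413] -/
theorem kind_cases_noTilde (v : VertexKind) (hadm : v.Admissible nbar) (h1315 : v.isOfForm1315 = false)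
    (h16 : v ≠ .v16) (h17 : v ≠ .v17) (ht : v.extVectorLegs = 0) :
    (∃ n, 1 ≤ n ∧ v = .v18 n 0) ∨ (∃ n, 2 ≤ n ∧ v = .v110 n 0) := by
  cases v with
  | v16 => exact absurd rfl h16
  | v17 => exact absurd rfl h17
  | v18 n n' =>
    simp only [VertexKind.extVectorLegs] at ht
    subst ht
    obtain ⟨-, -, h⟩ := hadm
    exact Or.inl ⟨n, by omega, rfl⟩
  | v19 n nb => simp [VertexKind.extVectorLegs] at ht
  | v110 n n' =>
    simp only [VertexKind.extVectorLegs] at ht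
    subst ht
    obtain ⟨-, -, -, h⟩ := hadm
    exact Or.inr ⟨n, by omega, rfl⟩
  | v111 n nb => simp [VertexKind.extVectorLegs] at ht
  | v113 => simp [VertexKind.isOfForm1315] at h1315
  | v114 n n' => simp [VertexKind.isOfForm1315] at h1315
  | v115 n nb => simp [VertexKind.isOfForm1315] at h1315

/-- kernel: an admissible catalogue vertex other than (1.6), (1.7), (1.13)–(1.15) with at most two legs of Ã is, for n̄ ≥ 2,
a vertex (1.8) (n + n′ ≥ 1) or (1.10) (n + n′ ≥ 2, even) — the R-vertices carry n̄ + 1 ≥ 3 legs of Ã.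
[cite: Balaban1983Higgs3, (1.8)–(1.11) p.413] -/
theorem kind_cases_tilde_le_two (hn : 2 ≤ nbar) (v : VertexKind) (hadm : v.Admissible nbar)
    (h1315 : v.isOfForm1315 = false) (h16 : v ≠ .v16) (h17 : v ≠ .v17) (ht : v.extVectorLegs ≤ 2) :
    (∃ n n', 1 ≤ n + n' ∧ v = .v18 n n') ∨ (∃ n n', 2 ≤ n + n' ∧ v = .v110 n n') := by
  cases v with
  | v16 => exact absurd rfl h16
  | v17 => exact absurd rfl h17
  | v18 n n' => obtain ⟨-, -, h⟩ := hadm; exact Or.inl ⟨n, n', h, rfl⟩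
  | v19 n nb => obtain ⟨h, -⟩ := hadm; simp [VertexKind.extVectorLegs] at ht; omega
  | v110 n n' => obtain ⟨-, -, -, h⟩ := hadm; exact Or.inr ⟨n, n', h, rfl⟩
  | v111 n nb => obtain ⟨h, -⟩ := hadm; simp [VertexKind.extVectorLegs] at ht; omega
  | v113 => simp [VertexKind.isOfForm1315] at h1315
  | v114 n n' => simp [VertexKind.isOfForm1315] at h1315
  | v115 n nb => simp [VertexKind.isOfForm1315] at h1315

variable (G : Graph nbar)

/-- kernel: no vertex (1.6) when their count vanishes. [cite: Balaban1983Higgs3, (1.6) p.413] -/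
theorem kind_ne_v16 (h : numV16 G = 0) (i : Fin G.nV) : G.kind i ≠ .v16 := fun hc => by
  have : i ∈ univ.filter fun i => G.kind i = .v16 := by simp [hc]
  rw [numV16, card_eq_zero] at h
  simp [h] at this

/-- kernel: no vertex (1.7) when their count vanishes. [cite: Balaban1983Higgs3, (1.7) p.413] -/
theorem kind_ne_v17 (h : numV17 G = 0) (i : Fin G.nV) : G.kind i ≠ .v17 := fun hc => by
  have : i ∈ univ.filter fun i => G.kind i = .v17 := by simp [hc]
  rw [numV17, card_eq_zero] at h
  simp [h] at this

/-- kernel: no Ã-leg at any vertex when the graph has none. [cite: Balaban1983Higgs3, (1.17) p.415] -/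
theorem extVectorLegs_eq_zero (h : numTildeLegs G = 0) (i : Fin G.nV) : (G.kind i).extVectorLegs = 0 :=
  (sum_eq_zero_iff.mp h) i (mem_univ i)

/-- kernel: the Ã-legs of one vertex are among those of the graph. [cite: Balaban1983Higgs3, (1.17) p.415] -/
theorem extVectorLegs_le (i : Fin G.nV) : (G.kind i).extVectorLegs ≤ numTildeLegs G :=
  single_le_sum (f := fun i => (G.kind i).extVectorLegs) (fun _ _ => Nat.zero_le _) (mem_univ i)

/-- kernel: a summand is at most the sum (ℕ). [cite: Balaban1983Higgs3, (2.1) p.422] -/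
theorem le_sum_of_mem (f : Fin G.nV → ℕ) (i : Fin G.nV) : f i ≤ ∑ j, f j :=
  single_le_sum (f := f) (fun _ _ => Nat.zero_le _) (mem_univ i)

/-- kernel: sums over the vertices of a one-vertex graph. [cite: Balaban1983Higgs3, p.415] -/
theorem sum_eq_of_nV_eq_one (hV : G.nV = 1) (i₀ : Fin G.nV) (f : Fin G.nV → ℕ) : ∑ i, f i = f i₀ := by
  have hsub : ∀ i j : Fin G.nV, i = j := fun i j => Fin.ext (by omega)
  have huniv : (univ : Finset (Fin G.nV)) = {i₀} := by ext i; simp [hsub i i₀]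
  simp [huniv]

/-- kernel: the two vertices of a two-vertex graph and the sums over them. [cite: Balaban1983Higgs3, p.415] -/
theorem two_vertices (hV : G.nV = 2) :
    ∃ i₀ i₁ : Fin G.nV, i₀ ≠ i₁ ∧ (∀ i, i = i₀ ∨ i = i₁) ∧ ∀ f : Fin G.nV → ℕ, ∑ i, f i = f i₀ + f i₁ := by
  refine ⟨⟨0, by omega⟩, ⟨1, by omega⟩, by simp [Fin.ext_iff], fun i => ?_, fun f => ?_⟩
  · have := i.isLt
    rcases Nat.lt_or_ge i.val 1 with h | h
    · exact Or.inl (Fin.ext (by simp; omega))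
    · exact Or.inr (Fin.ext (by simp; omega))
  · have huniv : (univ : Finset (Fin G.nV)) = {⟨0, by omega⟩, ⟨1, by omega⟩} := by
      ext i; simp only [mem_univ, mem_insert, mem_singleton, true_iff, Fin.ext_iff]; have := i.isLt; omega
    rw [huniv, sum_pair (by simp [Fin.ext_iff])]

end Kinds

/-! ## pp. 417–418: the counterterm truncations (1.23), (1.24) — higher orders have positive degree -/

section Truncation

variable (G : Graph nbar)

/-- **p. 417** [PDF 7] (before (1.23)), verbatim: *"the terms of order higher than 4 (in coupling constants) in the expansion of Σ_ε
are convergent also … we take a sum of terms of order ≤ 4: Σ_{2≤α+2β≤4} e^αλ^βΣ_{ε(α,β)}"* — the power counting behind it,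
PROVED on the model (d = 3): for a graph with two external φ′-legs only (the graphs of Σ_ε: vertices (1.6), (1.7), (1.8), (1.10)
at n′ = 0), 2·D(G) = (e-order) + 2·#(1.6) + 4·#(1.7) + 2·(external differentiations) − 4, so D(G) > 0 as soon as the order
α + 2β exceeds 4 — e-order α, λ-order β = #(1.6), each mass counterterm vertex (1.7) counted with its least order 2.
[cite: Balaban1983Higgs3, (1.23) p.417] -/
theorem two_deg_three_twoPoint (hG : ¬ G.HasVertex1315) (hs : numExtScalarLegs G = 2) (hv : numExtVectorLegs G = 0)
    (ht : numTildeLegs G = 0) :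
    2 * G.deg 3 = (eOrder G : ℚ) + 2 * numV16 G + 4 * numV17 G + 2 * numExtDiffs G - 4 := by
  rw [two_deg_three_eq_budget G hG, budget, eOrder_eq, hs, hv, ht]
  push_cast
  ring

/-- **p. 417** [PDF 7]: order α + 2β > 4 ⇒ D(G) > 0 for the graphs with two external φ′-legs only (d = 3; (1.7)-vertices counted
with order 2; a graph with a vertex (1.13)–(1.15) has D(G) > 0 anyway, Cor. 2.3). [cite: Balaban1983Higgs3, (1.23) p.417] -/
theorem deg_pos_of_order_gt_four (hs : numExtScalarLegs G = 2) (hv : numExtVectorLegs G = 0) (ht : numTildeLegs G = 0)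
    (hord : 4 < eOrder G + 2 * numV16 G + 2 * numV17 G) : 0 < G.deg 3 := by
  by_cases hG : G.HasVertex1315
  · exact B3Cor23ConcreteProof.deg_pos_of_hasVertex1315 G hG
  · have h := two_deg_three_twoPoint G hG hs hv ht
    have h' : (4 : ℚ) < eOrder G + 2 * numV16 G + 2 * numV17 G := by exact_mod_cast hord
    have : (0 : ℚ) ≤ numV17 G := Nat.cast_nonneg _
    have : (0 : ℚ) ≤ numExtDiffs G := Nat.cast_nonneg _
    linarith

/-- **p. 418** [PDF 8] (after (1.24)), verbatim: *"Terms of this expansion are described by connected graphs without external legs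
(vacuum graphs). To renormalize the theory it is sufficient to take the terms in the expansion (1.24) restricted by the condition
2 ≤ α + 2β ≤ 6; the other terms are convergent as ε → 0."* — the power counting behind it, PROVED on the model (d = 3): for a
graph without external legs, 2·D(G) = (e-order) + 2·#(1.6) + 4·#(1.7) + 2·(external differentiations) − 6.
[cite: Balaban1983Higgs3, (1.24) p.418] -/
theorem two_deg_three_vacuum (hG : ¬ G.HasVertex1315) (hs : numExtScalarLegs G = 0) (hv : numExtVectorLegs G = 0)
    (ht : numTildeLegs G = 0) :
    2 * G.deg 3 = (eOrder G : ℚ) + 2 * numV16 G + 4 * numV17 G + 2 * numExtDiffs G - 6 := by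
  rw [two_deg_three_eq_budget G hG, budget, eOrder_eq, hs, hv, ht]
  push_cast
  ring

/-- **p. 418** [PDF 8]: order α + 2β > 6 ⇒ D(G) > 0 for the vacuum graphs (d = 3; (1.7)-vertices counted with order 2).
[cite: Balaban1983Higgs3, (1.24) p.418] -/
theorem deg_pos_of_order_gt_six (hs : numExtScalarLegs G = 0) (hv : numExtVectorLegs G = 0) (ht : numTildeLegs G = 0)
    (hord : 6 < eOrder G + 2 * numV16 G + 2 * numV17 G) : 0 < G.deg 3 := by
  by_cases hG : G.HasVertex1315
  · exact B3Cor23ConcreteProof.deg_pos_of_hasVertex1315 G hG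
  · have h := two_deg_three_vacuum G hG hs hv ht
    have h' : (6 : ℚ) < eOrder G + 2 * numV16 G + 2 * numV17 G := by exact_mod_cast hord
    have : (0 : ℚ) ≤ numV17 G := Nat.cast_nonneg _
    have : (0 : ℚ) ≤ numExtDiffs G := Nat.cast_nonneg _
    linarith

end Truncation

end Literature.MathematicalPhysics.QuantumFieldTheory.Balaban1983to89.B3Sect3DegreeCensus
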